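import Summits.BirchSwinnertonDyer.BirchSwinnertonDyer.Theorems.EisensteinPrimesSplitMultIndexPlumbing
import Summits.BirchSwinnertonDyer.BirchSwinnertonDyer.Theorems.EisensteinPrimesStrictEqUnramifiedCommutator
import HarnessLib

/-!
# Route `SchneiderFreeAdditiveX3` (K1 door), crux r3 `GordTwoBranchIMC` (stmt-BirchSwinnertonDyer-19177): THE LOCAL `H⁰` PACKAGE AT `v̄` of
# the V21 index road in the «NO LOCAL FIXED VECTORS» orientation — BOTH residual characters non-trivial on `D_v̄` — and the plumbing step
# «unramified = strict at `v̄`» for a character non-trivial on `D_v̄`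

Cell `bsd-schneider-ideate`, seat `bsd-schneider-door-c5` (prover, generation 43; assembly layer; `--supports` 19177, helper).  PARTITION: board row
B6 ∩ X3 ∩ sst-twist, `r = 1`, the (G-ord, `e = 2`) half of `Rank1Residual.partition` — the 686 NON-ANOMALOUS census pairs at `p = 3` and the 307 pairs at
`p ≥ 5`; class-wide every pair of the cell whose two Jordan–Hölder characters are both non-trivial on `D_v̄`; types-the-object-of nothing new; closes none of
B6's cells (BSD NOT advanced).  bears_on: K1-door (items 18971/18972/18974 retired since rev 3 → live crux r3 19177).  FILE B of this generation's NAT port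
of cell `bsd-eis`'s V21 index road (FILE A = `…NATResidualIndexAssembly`, the mid-level identity without `+ p^c`).

## What

For a number field `K`, a `ℤ_p`-extension `κ` (`H = ker κ`), a place `v̄`, an elliptic curve `E/K` with `E(K)[p] = 0`, a residual pair `(θsub, θquot)` of
`E_K[p]` (Teichmüller characters, `θ^{p−1} = 1`) carried by a `Γ_K`-stable line `Φ` (`StableSubgroup`) with equivariant embeddings `j₁ : Φ ↪ (F/𝒪)(θsub)`,
`j₃ : E_K[p]/Φ ↪ (F/𝒪)(θquot)`, and the ORIENTATION HYPOTHESES «some `τ ∈ D_v̄` has `θsub(τ) ≠ 1`» AND «some `τ ∈ D_v̄` has `θquot(τ) ≠ 1`»: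
* §1 `eq_zero_of_fixed_inf_decomp_of_hom` — any `A ↪ (F/𝒪)(θ)` has no non-zero `(ker κ ⊓ D_v̄)`-fixed vector when `θ(τ) ≠ 1` for some `τ ∈ D_v̄`
  (`p`-power descent `CharResidualSelmerCount.noFixed_kerSubgroup_decomp_of_hom`, re-typed on the subtype `↥(ker κ ⊓ D_v̄)`); hence `Φ^{ker κ ⊓ D_v̄} = 0`
  AND `(E_K[p]/Φ)^{ker κ ⊓ D_v̄} = 0`; `geomTorsion_eq_zero_of_fixed_inf_decomp` — then `E_K[p]^{ker κ ⊓ D_v̄} = 0` (exactness of `0 → Φ → E_K[p] → E_K[p]/Φ → 0`);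
  `geomPrimaryTorsion_eq_zero_of_fixed_inf_decomp` — then `E_K[p^∞]^{ker κ ⊓ D_v̄} = 0` (induction on the exponent), so the `(ker κ ⊓ D_v̄)`-invariants of
  `E_K[p^∞]` are (vacuously) divisible in themselves (`hinvD₂` of FILE A).
* §2 `hZero_package_of_noLocalFixed` — the eleven `H⁰` conjuncts FILE A consumes, at its types: the six GLOBAL ones of `bsd-eis`'s `ResidualIndexHZero`
  (invariants of `(F/𝒪)(θsub)`, `E_K[p^∞]`, `(F/𝒪)(θquot)` under `ker κ` divisible in themselves; `E_K[p]^{ker κ} = 0`; `(E_K[p]/Φ)^{ker κ}` finite of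
  order `p^ε`, `ε = [θquot = 𝟙]`) and the five LOCAL ones of §1 (`Φ^{ker κ ⊓ D_v̄} = 0`, `(E_K[p]/Φ)^{ker κ ⊓ D_v̄} = 0`, the three `(ker κ ⊓ D_v̄)`-invariants
  divisible in themselves).
* §3 `lambdaInvariant_eq_zpCorank_grSelmer_of_decomp_ne_one` — the plumbing step (B2) for a character `θ` NON-TRIVIAL on `D_v̄` (ramified OR unramified with
  `θ(Frob_v̄) ≠ 1`): `λ(DS.X) = corank_{ℤ_p} H¹_{𝓕_Gr^{S₀}}(K_∞, (F/𝒪)(θ))` for every dual datum `DS` of the UNRAMIFIED group that is f.g. `Λ`-torsion with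
  `μ = 0` — cell `bsd-eis`'s `SplitMultIndexPlumbing.lambdaInvariant_eq_zpCorank_grSelmer_of_ramified` with its last step (x1-w4's «strict = unramified for a
  RAMIFIED character») replaced by x2-p2's UNCONDITIONAL `StrictEqUnramifiedCentral.grSelmer_charModule_eq_unrSelmer_of_decomp_ne_one` («`θ|_{G_v̄} ≠ 𝟙`»,
  `[D_v̄, D_v̄] ⊆ I_v̄` by `commutator_mem_inertia`).
No reduction hypothesis, no `p = 3`: the door feeds the two orientation hypotheses at `p = 3` (non-anomalous twists: AUX3 + `a₃(V) ≢ 1`) and at `p ≥ 5`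
(both characters ramified at `p`, F28a) in FILE E.

HONEST FRAMING: Galois-module bookkeeping (no definition, no named fact, no `sorry`, no `Theses` import); nothing about any L-function, main conjecture or
BSD is asserted; «closes rung: none».  References: [KellerYin2024] §1.3 Prop. 1.3.2, §1.4 Thm. 1.4.1 and its local analysis (arXiv:2402.12781v2 TeX
L919–953, L1087–1330); [GreenbergLNM1716] §3 Lemma 3.1, §4 p. 109; [CastellaGrossiLeeSkinner2022] proof of Thm. 1.2.2 («the same as the one defined by the
unramified local conditions»); cell `bsd-eis` files `…ResidualIndexHZero`, `…RamifiedCharNoLocalFixed`, `…SplitMultIndexPlumbing`, `…StrictEqUnramifiedCommutator`.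
-/

set_option autoImplicit false
-- the route's Theorems namespace repeats the summit name by design (D-0017 nested layout)
set_option linter.dupNamespace false

noncomputable section

open scoped Classical AddSubgroup

namespace Summit.BirchSwinnertonDyer.BirchSwinnertonDyer.Theorems.SchneiderFreeAdditiveX3.NATIndexLocalHZero

open Function NumberField IsDedekindDomain Field WeierstrassCurve
  Literature.NumberTheory.EllipticCurves Literature.NumberTheory.EllipticCurves.GreenbergSelmer
  Literature.NumberTheory.EllipticCurves.GreenbergVatsal2000 Literature.NumberTheory.GaloisRepresentations
  Literature.NumberTheory.EllipticCurves.KellerYin2024 Literature.NumberTheory.IwasawaTheory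
  Literature.NumberTheory.EllipticCurves.Rank1Residual Literature.NumberTheory.EllipticCurves.Castella2018
  Summit.BirchSwinnertonDyer.Rank1Residual Summit.BirchSwinnertonDyer.Rank1Residual.X2.ResidualDevissageModules
  Summit.BirchSwinnertonDyer.BirchSwinnertonDyer.Theorems
  Summit.BirchSwinnertonDyer.BirchSwinnertonDyer.Theorems.CharResidualSelmerCount

/-! ## §1. No local fixed vectors: the line, the quotient, `E_K[p]`, `E_K[p^∞]` -/

section NoFixed

variable {K : Type} [Field K] [NumberField K] {p : ℕ} [hp : Fact p.Prime] (κ : ZpExtension K p)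
  (vbar : HeightOneSpectrum (𝓞 K))

/-- **Any `A ↪ (F/𝒪)(θ)` (equivariant, injective; `θ^{p−1} = 1`) has no non-zero vector fixed by `ker κ ⊓ D_v̄`** when `θ(τ) ≠ 1` for some `τ ∈ D_v̄`:
cell `bsd-eis`'s `noFixed_kerSubgroup_decomp_of_hom` (`p`-power descent of `τ` into `D_v̄ ⊓ ker κ`; a `g` with `θ(g) ≠ 1` fixes only `0`), on the subtype
`↥(ker κ ⊓ D_v̄)` of FILE A's local hypotheses.  At `A = Φ`, `θ = θsub` this is `hN₁D`; at `A = E_K[p]/Φ`, `θ = θquot` it is `hN₃D`.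
[cite: KellerYin2024, §1.3 Prop. 1.3.2 and §1.4 (arXiv:2402.12781v2 TeX L919–953, L1178–1190)] [cite: GreenbergLNM1716, §4 p. 109] -/
theorem eq_zero_of_fixed_inf_decomp_of_hom (θ : FramedGaloisRep K (padicCoeffIntegers (∅ : Set (PadicAlgCl p))) 1)
    (hθ : ∀ σ : absoluteGaloisGroup K, θ σ ^ (p - 1) = 1)
    {A : Type} [AddCommGroup A] [DistribMulAction (absoluteGaloisGroup K) A]
    (j : A →+ charModule (∅ : Set (PadicAlgCl p)) θ)
    (hj : ∀ (σ : absoluteGaloisGroup K) (a : A), j (σ • a) = σ • j a) (hinj : Injective j)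
    (hD : ∃ τ ∈ decomp vbar, unitChar θ τ ≠ 1) :
    ∀ a : A, (∀ g : ↥(κ.kerSubgroup ⊓ decomp vbar), g • a = a) → a = 0 := by
  intro a ha
  obtain ⟨τ, hτ, hne⟩ := hD
  exact noFixed_kerSubgroup_decomp_of_hom κ θ hθ j hj hinj vbar hτ hne a
    (fun g hgk hgD ↦ ha ⟨g, Subgroup.mem_inf.mpr ⟨hgk, hgD⟩⟩)

variable (E : WeierstrassCurve K)

/-- **`E_K[p]^{ker κ ⊓ D_v̄} = 0` along a stable line whose ends have no local fixed vectors**: for a `Γ_K`-stable line `Φ` of `E_K[p]` with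
`Φ^{ker κ ⊓ D_v̄} = 0` and `(E_K[p]/Φ)^{ker κ ⊓ D_v̄} = 0`, a fixed `m ∈ E_K[p]` projects to a fixed, hence zero, class, so `m = Φ.incl a` with `a` fixed, hence
`0`. [cite: SerreGaloisCohomology1997, I §2.2 (exact sequence of invariants)] -/
theorem geomTorsion_eq_zero_of_fixed_inf_decomp
    (Φ : StableSubgroup (absoluteGaloisGroup K) ↥(E.geomTorsion (p : ℤ)))
    (hN₁D : ∀ n : Φ.Sub, (∀ g : ↥(κ.kerSubgroup ⊓ decomp vbar), g • n = n) → n = 0)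
    (hN₃D : ∀ n : Φ.Quot, (∀ g : ↥(κ.kerSubgroup ⊓ decomp vbar), g • n = n) → n = 0) :
    ∀ m : ↥(E.geomTorsion (p : ℤ)), (∀ g : ↥(κ.kerSubgroup ⊓ decomp vbar), g • m = m) → m = 0 := by
  intro m hm
  have hq : Φ.proj m = 0 := hN₃D _ fun g ↦ by
    change (g : absoluteGaloisGroup K) • Φ.proj m = Φ.proj m
    rw [← Φ.proj_smul]
    exact congrArg Φ.proj (hm g)
  obtain ⟨a, rfl⟩ := Φ.mem_range_incl_of_proj_eq_zero m hq
  have ha : ∀ g : ↥(κ.kerSubgroup ⊓ decomp vbar), g • a = a := fun g ↦ Φ.incl_injective (by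
    change Φ.incl ((g : absoluteGaloisGroup K) • a) = Φ.incl a
    rw [Φ.incl_smul]; exact hm g)
  rw [hN₁D a ha, map_zero]

/-- **`E_K[p^∞]^{ker κ ⊓ D_v̄} = 0` from `E_K[p]^{ker κ ⊓ D_v̄} = 0`**: a non-zero fixed point of exponent `p^{n+1}` has the non-zero fixed multiple
`p^n · x ∈ E_K[p]`; induction on the exponent. [cite: GreenbergLNM1716, §3 (Lemma 3.1, `B = E(F_∞)[p^∞]`)] -/
theorem geomPrimaryTorsion_eq_zero_of_fixed_inf_decomp
    (hE : ∀ m : ↥(E.geomTorsion (p : ℤ)), (∀ g : ↥(κ.kerSubgroup ⊓ decomp vbar), g • m = m) → m = 0)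
    (x : ↥(E.geomPrimaryTorsion p)) (hx : ∀ g : ↥(κ.kerSubgroup ⊓ decomp vbar), g • x = x) : x = 0 := by
  obtain ⟨n, hn⟩ := x.2
  have hpn : p ^ n • x = 0 := Subtype.ext (by rw [AddSubgroupClass.coe_nsmul, ZeroMemClass.coe_zero, ← hn])
  clear hn
  induction n generalizing x with
  | zero => simpa using hpn
  | succ n ih =>
    -- `y = p^n • x` is `p`-torsion and fixed, hence in `E_K[p]^{ker κ ⊓ D_v̄} = 0`
    have hy : p • (p ^ n • x) = 0 := by rw [← mul_nsmul', ← pow_succ', hpn]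
    have hyfix : ∀ g : ↥(κ.kerSubgroup ⊓ decomp vbar), g • (p ^ n • x) = p ^ n • x := fun g ↦ by rw [smul_comm, hx g]
    have hymem : (((p ^ n • x : ↥(E.geomPrimaryTorsion p))) : geomPoints E) ∈ E.geomTorsion (p : ℤ) :=
      AddSubgroup.torsionBy.nsmul_iff.mpr (by rw [← AddSubgroupClass.coe_nsmul, hy, ZeroMemClass.coe_zero])
    have h0 : (⟨_, hymem⟩ : ↥(E.geomTorsion (p : ℤ))) = 0 := by
      refine hE _ fun g ↦ Subtype.ext ?_
      have h := congrArg (fun z : ↥(E.geomPrimaryTorsion p) ↦ (z : geomPoints E)) (hyfix g)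
      exact h
    have hpn' : p ^ n • x = 0 := Subtype.ext (by
      have h := congrArg (fun z : ↥(E.geomTorsion (p : ℤ)) ↦ (z : geomPoints E)) h0
      exact h)
    exact ih x hx hpn'

/-- **The `(ker κ ⊓ D_v̄)`-invariants of `E_K[p^∞]` are (vacuously) `p`-divisible in themselves** when `E_K[p]^{ker κ ⊓ D_v̄} = 0` — the `hinvD₂`
hypothesis of FILE A (`ker(j_{2,D*}) = E(K_{∞,w})[p^∞]/p = 0`). [cite: GreenbergLNM1716, §3 Lemma 3.1] [cite: KellerYin2024, §1.4 (arXiv:2402.12781v2 TeX L1240–1260)] -/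
theorem geomPrimaryTorsion_inf_decomp_invariants_divisible
    (hE : ∀ m : ↥(E.geomTorsion (p : ℤ)), (∀ g : ↥(κ.kerSubgroup ⊓ decomp vbar), g • m = m) → m = 0) :
    ∀ x : ↥(E.geomPrimaryTorsion p), (∀ g : ↥(κ.kerSubgroup ⊓ decomp vbar), g • x = x) →
      ∃ x' : ↥(E.geomPrimaryTorsion p), (∀ g : ↥(κ.kerSubgroup ⊓ decomp vbar), g • x' = x') ∧ p • x' = x :=
  fun x hx ↦ ⟨0, fun g ↦ smul_zero _, by
    rw [geomPrimaryTorsion_eq_zero_of_fixed_inf_decomp κ vbar E hE x hx, smul_zero]⟩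

end NoFixed

/-! ## §2. The `H⁰` package of FILE A at the door's currency (`W/ℚ` base-changed to `K`) -/

section Package

variable {K : Type} [Field K] [NumberField K] {p : ℕ} [hp : Fact p.Prime]

/-- **THE `H⁰` PACKAGE OF THE NAT INDEX ROAD** (the six global and five local `H⁰` hypotheses of FILE A's
`NATIndexAssembly.zpCorank_datumStrictSelmer_add_eq_of_noLocalFixed`, in its order and types), on the binders: `W/ℚ`, `K` a number field with
`W(K)[p] = 0`, `κ` a `ℤ_p`-extension, `v̄` a place, `(θsub, θquot)` a residual pair of `W_K[p]`, ANY `Γ_K`-stable line `Φ` of `W_K[p]` with `#(W_K[p]/Φ) = p`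
and equivariant embeddings `j₁ : Φ ↪ (F/𝒪)(θsub)`, `j₃ : W_K[p]/Φ ↪ (F/𝒪)(θquot)`, GIVEN the two orientation hypotheses «some `τ ∈ D_v̄` has `θsub(τ) ≠ 1`»
and «some `τ ∈ D_v̄` has `θquot(τ) ≠ 1`»: (1)–(3) the `ker κ`-invariants of `(F/𝒪)(θsub)`, `W_K[p^∞]`, `(F/𝒪)(θquot)` are `p`-divisible in themselves;
(4) `W_K[p]^{ker κ} = 0`; (5)–(6) `(W_K[p]/Φ)^{ker κ}` finite of order `p^ε`, `ε = [θquot = 𝟙]`; (7) `Φ^{ker κ ⊓ D_v̄} = 0`; (8) `(W_K[p]/Φ)^{ker κ ⊓ D_v̄} = 0`;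
(9)–(11) the `ker κ ⊓ D_v̄`-invariants of `(F/𝒪)(θsub)`, `W_K[p^∞]`, `(F/𝒪)(θquot)` divisible in themselves.  Globals: `bsd-eis`'s `ResidualIndexHZero`; locals: §1.
[cite: KellerYin2024, §1.4 Thm. 1.4.1 and its local analysis (arXiv:2402.12781v2 TeX L1066–1098, L1178–1330)] [cite: GreenbergLNM1716, §1 p. 62, §3 Lemma 3.1, §4 p. 109] -/
theorem hZero_package_of_noLocalFixed (W : WeierstrassCurve ℚ) [W.IsElliptic] (p : ℕ) [Fact p.Prime]
    (K : Type) [Field K] [NumberField K]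
    (htor : ∀ Q : (W.baseChange K).toAffine.Point, p • Q = 0 → Q = 0)
    (vbar : HeightOneSpectrum (𝓞 K)) (κ : ZpExtension K p)
    (θsub θquot : FramedGaloisRep K (padicCoeffIntegers (∅ : Set (PadicAlgCl p))) 1)
    (hpair : IsResidualPairOver (W.baseChange K) p θsub θquot)
    (hsubD : ∃ τ ∈ decomp vbar, unitChar θsub τ ≠ 1) (hquotD : ∃ τ ∈ decomp vbar, unitChar θquot τ ≠ 1)
    (Φ : StableSubgroup (absoluteGaloisGroup K) ↥((W.baseChange K).geomTorsion (p : ℤ)))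
    (hQuot : Nat.card Φ.Quot = p)
    (j₁ : Φ.Sub →+ charModule ∅ θsub)
    (hj₁ : ∀ (g : absoluteGaloisGroup K) (a : Φ.Sub), j₁ (g • a) = g • j₁ a) (hj₁inj : Function.Injective j₁)
    (j₃ : Φ.Quot →+ charModule ∅ θquot)
    (hj₃ : ∀ (g : absoluteGaloisGroup K) (a : Φ.Quot), j₃ (g • a) = g • j₃ a) (hj₃inj : Function.Injective j₃) :
    -- global H⁰
    (∀ x : (charModule ∅ θsub), (∀ g : ↥κ.kerSubgroup, g • x = x) → ∃ x' : (charModule ∅ θsub), (∀ g : ↥κ.kerSubgroup, g • x' = x') ∧ p • x' = x) ∧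
    (∀ x : ↥((W.baseChange K).geomPrimaryTorsion p), (∀ g : ↥κ.kerSubgroup, g • x = x) → ∃ x' : ↥((W.baseChange K).geomPrimaryTorsion p), (∀ g : ↥κ.kerSubgroup, g • x' = x') ∧ p • x' = x) ∧
    (∀ x : (charModule ∅ θquot), (∀ g : ↥κ.kerSubgroup, g • x = x) → ∃ x' : (charModule ∅ θquot), (∀ g : ↥κ.kerSubgroup, g • x' = x') ∧ p • x' = x) ∧
    (∀ n : ↥((W.baseChange K).geomTorsion (p : ℤ)), (∀ g : ↥κ.kerSubgroup, g • n = n) → n = 0) ∧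
    Finite {n : Φ.Quot // ∀ g : ↥κ.kerSubgroup, g • n = n} ∧
    Nat.card {n : Φ.Quot // ∀ g : ↥κ.kerSubgroup, g • n = n} = p ^ (if ∀ σ : absoluteGaloisGroup K, θquot σ = 1 then 1 else 0) ∧
    -- local H⁰ at `H ⊓ D_v̄`, «no local fixed vectors»
    (∀ n : Φ.Sub, (∀ g : ↥(κ.kerSubgroup ⊓ decomp vbar), g • n = n) → n = 0) ∧
    (∀ n : Φ.Quot, (∀ g : ↥(κ.kerSubgroup ⊓ decomp vbar), g • n = n) → n = 0) ∧
    (∀ x : (charModule ∅ θsub), (∀ g : ↥(κ.kerSubgroup ⊓ decomp vbar), g • x = x) → ∃ x' : (charModule ∅ θsub), (∀ g : ↥(κ.kerSubgroup ⊓ decomp vbar), g • x' = x') ∧ p • x' = x) ∧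
    (∀ x : ↥((W.baseChange K).geomPrimaryTorsion p), (∀ g : ↥(κ.kerSubgroup ⊓ decomp vbar), g • x = x) → ∃ x' : ↥((W.baseChange K).geomPrimaryTorsion p), (∀ g : ↥(κ.kerSubgroup ⊓ decomp vbar), g • x' = x') ∧ p • x' = x) ∧
    (∀ x : (charModule ∅ θquot), (∀ g : ↥(κ.kerSubgroup ⊓ decomp vbar), g • x = x) → ∃ x' : (charModule ∅ θquot), (∀ g : ↥(κ.kerSubgroup ⊓ decomp vbar), g • x' = x') ∧ p • x' = x) := by
  have hpr : p.Prime := Fact.out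
  haveI hEK : (W.baseChange K).IsElliptic := inferInstanceAs (W.map (algebraMap ℚ K)).IsElliptic
  have hθsub : ∀ σ : absoluteGaloisGroup K, θsub σ ^ (p - 1) = 1 := fun σ ↦ (hpair.pow_sub_one σ).1
  have hθquot : ∀ σ : absoluteGaloisGroup K, θquot σ ^ (p - 1) = 1 := fun σ ↦ (hpair.pow_sub_one σ).2
  haveI : Finite Φ.Quot := Nat.finite_of_card_ne_zero (by rw [hQuot]; exact hpr.ne_zero)
  have hN₁D : ∀ n : Φ.Sub, (∀ g : ↥(κ.kerSubgroup ⊓ decomp vbar), g • n = n) → n = 0 :=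
    eq_zero_of_fixed_inf_decomp_of_hom κ vbar θsub hθsub j₁ hj₁ hj₁inj hsubD
  have hN₃D : ∀ n : Φ.Quot, (∀ g : ↥(κ.kerSubgroup ⊓ decomp vbar), g • n = n) → n = 0 :=
    eq_zero_of_fixed_inf_decomp_of_hom κ vbar θquot hθquot j₃ hj₃ hj₃inj hquotD
  exact ⟨ResidualIndexHZero.charModule_subgroup_invariants_divisible θsub hθsub κ.kerSubgroup,
    ResidualIndexHZero.geomPrimaryTorsion_kerSubgroup_invariants_divisible κ (W.baseChange K) htor,
    ResidualIndexHZero.charModule_subgroup_invariants_divisible θquot hθquot κ.kerSubgroup,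
    ResidualIndexHZero.geomTorsion_eq_zero_of_forall_kerSubgroup_smul_eq κ (W.baseChange K) htor,
    inferInstance,
    ResidualIndexHZero.natCard_fixed_kerSubgroup_eq θquot κ hθquot hQuot j₃ hj₃ hj₃inj,
    hN₁D, hN₃D,
    ResidualIndexHZero.charModule_subgroup_invariants_divisible θsub hθsub _,
    geomPrimaryTorsion_inf_decomp_invariants_divisible κ vbar (W.baseChange K)
      (geomTorsion_eq_zero_of_fixed_inf_decomp κ vbar (W.baseChange K) Φ hN₁D hN₃D),
    ResidualIndexHZero.charModule_subgroup_invariants_divisible θquot hθquot _⟩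

/-- **Under the two orientation hypotheses `θquot ≠ 𝟙`, so `ε = 0`**: the indicator `[θquot = 𝟙]` of the package vanishes (a `τ ∈ D_v̄` with `θquot(τ) ≠ 1`
is a witness). [cite: KellerYin2024, §1.4 (arXiv:2402.12781v2 TeX L1087–1098) (`ε = 0` unless `θ = 𝟙`)] -/
theorem indicator_eq_zero_of_exists_unitChar_ne_one (vbar : HeightOneSpectrum (𝓞 K))
    (θquot : FramedGaloisRep K (padicCoeffIntegers (∅ : Set (PadicAlgCl p))) 1)
    (hquotD : ∃ τ ∈ decomp vbar, unitChar θquot τ ≠ 1) :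
    (if ∀ σ : absoluteGaloisGroup K, θquot σ = 1 then 1 else 0 : ℕ) = 0 := by
  obtain ⟨τ, -, hne⟩ := hquotD
  rw [if_neg]
  intro h
  exact hne (CharLocalInertiaFrobenius.unitChar_eq_one_of_apply_eq_one θquot (h τ))

end Package

/-! ## §3. Plumbing step (B2) for a character non-trivial on `D_v̄`: `λ(𝔛_nr) = corank_{ℤ_p} H¹_{𝓕_Gr}` -/

section Plumbing

variable {K : Type} [Field K] [NumberField K] {p : ℕ} [hp : Fact p.Prime] (κ : ZpExtension K p)
  (vbar : HeightOneSpectrum (𝓞 K)) (S₀ : Set (HeightOneSpectrum (𝓞 K)))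
  (θ : FramedGaloisRep K (padicCoeffIntegers (∅ : Set (PadicAlgCl p))) 1)

/-- **(B2), character level, for a character NON-TRIVIAL on `D_v̄`: `λ(DS.X) = zpCorank H¹_{𝓕_Gr^{S₀}}(K_∞, (F/𝒪)(θ))`** for a Teichmüller character `θ`
(`θ^{p−1} = 1`) with some `τ ∈ D_v̄`, `θ(τ) ≠ 1` (RAMIFIED at `v̄`, or unramified with `θ(Frob_v̄) ≠ 1`), EVERY `ℤ_p`-extension `κ`, every `S₀`, and any
Pontryagin-dual datum `DS` of `H¹_{𝓕_nr^{S₀}}(K_∞, (F/𝒪)(θ))` that is f.g. `Λ`-torsion with `μ = 0`: `λ = corank_{ℤ_p}` of the character group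
(`X2.NonPrimitiveSelmerCorank.finite_torsionBy_and_zpCorank_eq_lambdaInvariant`) and STRICT = UNRAMIFIED at `v̄` for a character non-trivial on `D_v̄`
(`StrictEqUnramifiedCentral.grSelmer_charModule_eq_unrSelmer_of_decomp_ne_one`, UNCONDITIONAL; `[D_v̄, D_v̄] ⊆ I_v̄` by `commutator_mem_inertia`).  Cell
`bsd-eis`'s `SplitMultIndexPlumbing.lambdaInvariant_eq_zpCorank_grSelmer_of_ramified` is the ramified case.
[cite: KellerYin2024, proof of Lemma 1.2.4 and Thm. 1.4.1 (iii) (arXiv:2402.12781v2 TeX L790–795, L1087–1098)]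
[cite: CastellaGrossiLeeSkinner2022, proof of Thm. 1.2.2 (strict = unramified for `θ|_{G_v̄} ≠ 𝟙`)] [cite: GreenbergLNM1716, §1 p. 60] -/
theorem lambdaInvariant_eq_zpCorank_grSelmer_of_decomp_ne_one (hθ : ∀ σ : absoluteGaloisGroup K, θ σ ^ (p - 1) = 1)
    (hD : ∃ τ ∈ decomp vbar, unitChar θ τ ≠ 1) {γ : absoluteGaloisGroup K}
    (DS : DatumDualData κ γ (charModule (∅ : Set (PadicAlgCl p)) θ)
      (AcSelmer.bdpData (charModule (∅ : Set (PadicAlgCl p)) θ) p vbar) S₀)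
    [Module.Finite (IwasawaAlgebra p) DS.X] (htor : Module.IsTorsion (IwasawaAlgebra p) DS.X)
    (hμ : muInvariant p DS.X = 0) :
    lambdaInvariant p DS.X = zpCorank ↥(grSelmer κ (charModule (∅ : Set (PadicAlgCl p)) θ) vbar S₀) p := by
  obtain ⟨τ, hτ, hne1⟩ := hD
  have hprimU : ∀ u : ↥(unrSelmer κ (charModule (∅ : Set (PadicAlgCl p)) θ) vbar S₀), ∃ n : ℕ, p ^ n • u = 0 :=
    fun u ↦ by
      obtain ⟨n, hn⟩ := GreenbergSelmer.exists_pow_smul_subgroupH1_eq_zero κ (charModule (∅ : Set (PadicAlgCl p)) θ)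
        (GreenbergSelmer.exists_pow_smul_cofree_eq_zero (∅ : Set (PadicAlgCl p)) θ)
        (u : subgroupH1 κ.kerSubgroup (charModule (∅ : Set (PadicAlgCl p)) θ))
      exact ⟨n, Subtype.ext (by rw [AddSubgroupClass.coe_nsmul]; exact hn)⟩
  obtain ⟨-, hcork⟩ :=
    X2.NonPrimitiveSelmerCorank.finite_torsionBy_and_zpCorank_eq_lambdaInvariant p DS.X htor hμ hprimU DS.toDualEquiv
  rw [← hcork, StrictEqUnramifiedCentral.grSelmer_charModule_eq_unrSelmer_of_decomp_ne_one κ vbar S₀ θ hθ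
    (fun _ hx _ hy ↦ StrictEqUnramifiedCentral.commutator_mem_inertia vbar hx hy) hτ hne1]

/-- **(B2) for a character non-trivial on `D_v̄`, with the cotorsion facts in the road's `∀ D` form**, instantiated at `DS`.
[cite: KellerYin2024, Thm. 1.4.1 (i)–(iii) (arXiv:2402.12781v2 TeX L1087–1098)] -/
theorem lambdaInvariant_eq_zpCorank_grSelmer_of_decomp_ne_one_of_forall (hθ : ∀ σ : absoluteGaloisGroup K, θ σ ^ (p - 1) = 1)
    (hD : ∃ τ ∈ decomp vbar, unitChar θ τ ≠ 1) {γ : absoluteGaloisGroup K}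
    (DS : DatumDualData κ γ (charModule (∅ : Set (PadicAlgCl p)) θ)
      (AcSelmer.bdpData (charModule (∅ : Set (PadicAlgCl p)) θ) p vbar) S₀)
    (hS : ∀ D : DatumDualData κ γ (charModule (∅ : Set (PadicAlgCl p)) θ)
        (AcSelmer.bdpData (charModule (∅ : Set (PadicAlgCl p)) θ) p vbar) S₀,
      Module.Finite (IwasawaAlgebra p) D.X ∧ Module.IsTorsion (IwasawaAlgebra p) D.X ∧ muInvariant p D.X = 0) :
    lambdaInvariant p DS.X = zpCorank ↥(grSelmer κ (charModule (∅ : Set (PadicAlgCl p)) θ) vbar S₀) p := by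
  obtain ⟨hfg, htor, hμ⟩ := hS DS
  haveI := hfg
  exact lambdaInvariant_eq_zpCorank_grSelmer_of_decomp_ne_one κ vbar S₀ θ hθ hD DS htor hμ

end Plumbing

end Summit.BirchSwinnertonDyer.BirchSwinnertonDyer.Theorems.SchneiderFreeAdditiveX3.NATIndexLocalHZero

end
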